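import Summits.AtomisticToContinuum.HydrodynamicLimit.Theorems.StiffCollisionalRelaxationAprioriBoundsMesoPartTwoTools
import Mathlib.Probability.Moments.Variance
import HarnessLib

/-!
# The mesoscopic Chebyshev window at fixed `N` (line `meso-chebyshev-window` of the crux `AprioriBounds`,
stmt-AtomisticToContinuum-14827): grid + Chebyshev + sure inclusion + union bound

Support file (`--supports stmt-AtomisticToContinuum-14827`) for the registered stub
`stub_partTwo_of_meanVariance`.  For ONE hard-sphere flow `Ψ` of `N + 1` spheres, a finite law `P` with
`P(goodᶜ) = 0`, a kernel `φ` and the block density `ρ̄(s, x)(z) = empiricalDensityField (Ψ_s z) (φ(· − x))`: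
given pathwise moduli `L_s` (in time, on good orbits of energy per sphere `≤ E₀`) and `L_x` (in the centre),
a floor `m ≤ E ρ̄`, a ceiling `E ρ̄ · σ₃ ≤ κ` and a variance bound `Var ρ̄ ≤ A₀` at every `(s, x) ∈ [0,t] × 𝕋³`,
the no-vacuum/no-jam failure event is controlled by the energy event plus `(M + 1) n³ A₀ / δ²`
(`measure_badEvent_le`), where `M + 1` and `n³` count the nets of `[0, t]` and `𝕋³` at the meshes
`t/M ≤ δ/L_s`, `1/n ≤ δ/L_x` (`exists_net_Icc`, `exists_net_T3`), each grid deviation event being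
Chebyshev-small (`ProbabilityTheory.meas_ge_le_variance_div_sq`).
-/

noncomputable section

open MeasureTheory ProbabilityTheory Filter Set Topology
open scoped ENNReal

namespace Summit.AtomisticToContinuum.HydrodynamicLimit.Theorems.MesoChebyshevWindow

open Literature.MathematicalPhysics.KineticTheory Literature.Analysis.FluidPDE

variable {N : ℕ}

/-- The kinetic energy is `N + 1` times the empirical energy field tested against `1`:
`½ ∑ᵢ |vᵢ|² = (N+1) · (N+1)⁻¹ ∑ᵢ 1 · |vᵢ|²/2`. -/
theorem configEnergy_eq_succ_mul_empiricalEnergyField (w : Config (N + 1) (Fin 3) T3) :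
    configEnergy w = ((N + 1 : ℕ) : ℝ) * empiricalEnergyField w (fun _ => 1) := by
  have hn : ((N + 1 : ℕ) : ℝ) ≠ 0 := by positivity
  rw [empiricalEnergyField_eq_sum, ← mul_assoc, mul_inv_cancel₀ hn, one_mul, configEnergy, Finset.mul_sum]
  exact Finset.sum_congr rfl fun i _ => by ring

/-- **The sure inclusion.**  Off the bad set, off the energy event and off every grid deviation event,
the block density stays in `[m/2, 1/σ₃]` on all of `[0, t] × 𝕋³`; that is, the failure event
`{∃ s ∈ [0,t], ∃ x, ρ̄(s,x) < m/2 ∨ 1 < ρ̄(s,x) σ₃}` is contained in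
`goodᶜ ∪ {E₀ < e(Ψ₀ z)} ∪ ⋃_{grid} {δ ≤ |ρ̄(s_j, x_k) − E ρ̄(s_j, x_k)|}` as soon as the meshes resolve `δ`
(`L_s · mesh_t ≤ δ`, `L_x · mesh_x ≤ δ`), `3δ < m/2` and `κ + 3δσ₃ ≤ 1`. -/
theorem badEvent_subset {ε : ℝ} (Ψ : HardSphereFlow (Torus.geometry (Fin 3)) ε (N + 1))
    (φ : T3 → ℝ) (mean : ℝ → T3 → ℝ) {t E₀ m κ δ σ₃ Ls Lx τ ξ : ℝ}
    (hLs : ∀ z ∈ Ψ.good, empiricalEnergyField (Ψ.flow 0 z) (fun _ => 1) ≤ E₀ → ∀ (s s' : ℝ) (x : T3),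
      |empiricalDensityField (Ψ.flow s' z) (fun y => φ (y - x)) -
          empiricalDensityField (Ψ.flow s z) (fun y => φ (y - x))| ≤ Ls * |s' - s|)
    (hLx : ∀ z ∈ Ψ.good, ∀ (s : ℝ) (x x' : T3),
      |empiricalDensityField (Ψ.flow s z) (fun y => φ (y - x)) -
          empiricalDensityField (Ψ.flow s z) (fun y => φ (y - x'))| ≤ Lx * ‖x - x'‖)
    (hLs0 : 0 ≤ Ls) (hLx0 : 0 ≤ Lx) (hτ : Ls * τ ≤ δ) (hξ : Lx * ξ ≤ δ)
    (St : Finset ℝ) (hSt : ∀ s ∈ St, s ∈ Icc 0 t) (hSt' : ∀ s ∈ Icc 0 t, ∃ s' ∈ St, |s - s'| ≤ τ)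
    (Gx : Finset T3) (hGx : ∀ x : T3, ∃ g ∈ Gx, ‖x - g‖ ≤ ξ)
    (hfloor : ∀ s ∈ Icc 0 t, ∀ x : T3, m ≤ mean s x) (hceil : ∀ s ∈ Icc 0 t, ∀ x : T3, mean s x * σ₃ ≤ κ)
    (hδ1 : 3 * δ < m / 2) (hσ₃ : 0 ≤ σ₃) (hδ2 : κ + 3 * δ * σ₃ ≤ 1) :
    {z | ∃ s ∈ Icc 0 t, ∃ x : T3,
        empiricalDensityField (Ψ.flow s z) (fun y => φ (y - x)) < m / 2 ∨
          1 < empiricalDensityField (Ψ.flow s z) (fun y => φ (y - x)) * σ₃} ⊆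
      (Ψ.goodᶜ ∪ {z | E₀ < empiricalEnergyField (Ψ.flow 0 z) (fun _ => 1)}) ∪
        ⋃ s ∈ St, ⋃ x ∈ Gx, {z | δ ≤ |empiricalDensityField (Ψ.flow s z) (fun y => φ (y - x)) - mean s x|} := by
  intro z hz
  obtain ⟨s, hs, x, hbad⟩ := hz
  by_cases hg : z ∈ Ψ.good
  swap
  · exact Or.inl (Or.inl hg)
  by_cases hen : E₀ < empiricalEnergyField (Ψ.flow 0 z) (fun _ => 1)
  · exact Or.inl (Or.inr hen)
  right
  obtain ⟨s', hs'S, hss'⟩ := hSt' s hs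
  obtain ⟨x', hx'G, hxx'⟩ := hGx x
  simp only [Set.mem_iUnion, exists_prop]
  refine ⟨s', hs'S, x', hx'G, ?_⟩
  rw [Set.mem_setOf_eq]
  by_contra hlt
  push Not at hlt hen
  have h1 : |empiricalDensityField (Ψ.flow s z) (fun y => φ (y - x)) -
      empiricalDensityField (Ψ.flow s' z) (fun y => φ (y - x))| ≤ δ :=
    (hLs z hg hen s' s x).trans ((mul_le_mul_of_nonneg_left hss' hLs0).trans hτ)
  have h2 : |empiricalDensityField (Ψ.flow s' z) (fun y => φ (y - x)) -
      empiricalDensityField (Ψ.flow s' z) (fun y => φ (y - x'))| ≤ δ :=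
    (hLx z hg s' x x').trans ((mul_le_mul_of_nonneg_left hxx' hLx0).trans hξ)
  have hfl := hfloor s' (hSt s' hs'S) x'
  have hce := hceil s' (hSt s' hs'S) x'
  rw [abs_le] at h1 h2
  rw [abs_lt] at hlt
  rcases hbad with hlow | hhigh
  · linarith
  · have hup : empiricalDensityField (Ψ.flow s z) (fun y => φ (y - x)) ≤ mean s' x' + 3 * δ := by linarith
    have := mul_le_mul_of_nonneg_right hup hσ₃
    nlinarith

/-- **The window at fixed `N`.**  For a finite law `P` carried by the good set, the failure event is
bounded by the energy event plus `(M + 1) · n³ · A₀/δ²`: nets of `[0, t]` (`M + 1` points, mesh `t/M`)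
and of `𝕋³` (`n³` points, mesh `1/n`) at meshes resolving `δ` through the moduli `L_s`, `L_x`
(`t L_s < M δ`, `L_x < n δ`), Chebyshev at each grid point (`MemLp 2`, `Var ≤ A₀`), the sure inclusion
`badEvent_subset`, and the union bound. -/
theorem measure_badEvent_le {ε : ℝ} (Ψ : HardSphereFlow (Torus.geometry (Fin 3)) ε (N + 1))
    (P : Measure (Config (N + 1) (Fin 3) T3)) [IsFiniteMeasure P] (hgood : P Ψ.goodᶜ = 0)
    (φ : T3 → ℝ) {t E₀ m κ δ σ₃ Ls Lx A₀ : ℝ} {M n : ℕ}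
    (hLs : ∀ z ∈ Ψ.good, empiricalEnergyField (Ψ.flow 0 z) (fun _ => 1) ≤ E₀ → ∀ (s s' : ℝ) (x : T3),
      |empiricalDensityField (Ψ.flow s' z) (fun y => φ (y - x)) -
          empiricalDensityField (Ψ.flow s z) (fun y => φ (y - x))| ≤ Ls * |s' - s|)
    (hLx : ∀ z ∈ Ψ.good, ∀ (s : ℝ) (x x' : T3),
      |empiricalDensityField (Ψ.flow s z) (fun y => φ (y - x)) -
          empiricalDensityField (Ψ.flow s z) (fun y => φ (y - x'))| ≤ Lx * ‖x - x'‖)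
    (hLs0 : 0 ≤ Ls) (hLx0 : 0 ≤ Lx) (ht : 0 < t) (hδ : 0 < δ) (hM : t * Ls < M * δ) (hn : Lx < n * δ)
    (hfloor : ∀ s ∈ Icc 0 t, ∀ x : T3,
      m ≤ ∫ z, empiricalDensityField (Ψ.flow s z) (fun y => φ (y - x)) ∂P)
    (hceil : ∀ s ∈ Icc 0 t, ∀ x : T3,
      (∫ z, empiricalDensityField (Ψ.flow s z) (fun y => φ (y - x)) ∂P) * σ₃ ≤ κ)
    (hvar : ∀ s ∈ Icc 0 t, ∀ x : T3,
      MemLp (fun z => empiricalDensityField (Ψ.flow s z) (fun y => φ (y - x))) 2 P ∧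
        variance (fun z => empiricalDensityField (Ψ.flow s z) (fun y => φ (y - x))) P ≤ A₀)
    (hδ1 : 3 * δ < m / 2) (hσ₃ : 0 ≤ σ₃) (hδ2 : κ + 3 * δ * σ₃ ≤ 1) :
    P {z | ∃ s ∈ Icc 0 t, ∃ x : T3,
        empiricalDensityField (Ψ.flow s z) (fun y => φ (y - x)) < m / 2 ∨
          1 < empiricalDensityField (Ψ.flow s z) (fun y => φ (y - x)) * σ₃} ≤
      P {z | E₀ < empiricalEnergyField (Ψ.flow 0 z) (fun _ => 1)} +
        ENNReal.ofReal (((M : ℝ) + 1) * (n : ℝ) ^ 3 * (A₀ / δ ^ 2)) := by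
  classical
  -- positivity of the counts
  have hMpos : 0 < M := by
    rcases Nat.eq_zero_or_pos M with h | h
    · subst h; simp at hM; nlinarith
    · exact h
  have hnpos : 0 < n := by
    rcases Nat.eq_zero_or_pos n with h | h
    · subst h; simp at hn; linarith
    · exact h
  have hMr : (0 : ℝ) < M := by exact_mod_cast hMpos
  have hnr : (0 : ℝ) < n := by exact_mod_cast hnpos
  -- meshes
  have hτ : Ls * (t / M) ≤ δ := by
    rw [mul_div_assoc', div_le_iff₀ hMr, mul_comm Ls t]
    linarith
  have hξ : Lx * (1 / n) ≤ δ := by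
    rw [mul_one_div, div_le_iff₀ hnr]
    linarith
  -- nets
  obtain ⟨St, hStc, hSt, hSt'⟩ := exists_net_Icc ht hMpos
  obtain ⟨Gx, hGxc, hGx⟩ := exists_net_T3 hnpos
  -- the grid deviation events are Chebyshev-small
  set mean : ℝ → T3 → ℝ := fun s x => ∫ z, empiricalDensityField (Ψ.flow s z) (fun y => φ (y - x)) ∂P
    with hmean
  set D : ℝ → T3 → Set (Config (N + 1) (Fin 3) T3) := fun s x =>
    {z | δ ≤ |empiricalDensityField (Ψ.flow s z) (fun y => φ (y - x)) - mean s x|} with hD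
  have hDle : ∀ s ∈ St, ∀ x : T3, P (D s x) ≤ ENNReal.ofReal (A₀ / δ ^ 2) := by
    intro s hs x
    obtain ⟨hmem, hv⟩ := hvar s (hSt s hs) x
    calc P (D s x) ≤ ENNReal.ofReal (variance (fun z =>
          empiricalDensityField (Ψ.flow s z) (fun y => φ (y - x))) P / δ ^ 2) :=
          meas_ge_le_variance_div_sq hmem hδ
      _ ≤ ENNReal.ofReal (A₀ / δ ^ 2) :=
          ENNReal.ofReal_le_ofReal (div_le_div_of_nonneg_right hv (sq_nonneg _))
  -- the sure inclusion
  have hincl := badEvent_subset Ψ φ mean (t := t) (E₀ := E₀) hLs hLx hLs0 hLx0 hτ hξ St hSt hSt' Gx hGx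
    (fun s hs x => hfloor s hs x) (fun s hs x => hceil s hs x) hδ1 hσ₃ hδ2
  -- the union bound
  have hU : P (⋃ s ∈ St, ⋃ x ∈ Gx, D s x) ≤ ∑ s ∈ St, ∑ x ∈ Gx, P (D s x) :=
    (measure_biUnion_finset_le St fun s => ⋃ x ∈ Gx, D s x).trans
      (Finset.sum_le_sum fun s _ => measure_biUnion_finset_le Gx fun x => D s x)
  have hsum : ∑ s ∈ St, ∑ x ∈ Gx, P (D s x) ≤ ENNReal.ofReal (((M : ℝ) + 1) * (n : ℝ) ^ 3 * (A₀ / δ ^ 2)) := by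
    calc ∑ s ∈ St, ∑ x ∈ Gx, P (D s x) ≤ ∑ s ∈ St, ∑ _x ∈ Gx, ENNReal.ofReal (A₀ / δ ^ 2) :=
          Finset.sum_le_sum fun s hs => Finset.sum_le_sum fun x _ => hDle s hs x
      _ = (St.card : ℝ≥0∞) * ((Gx.card : ℝ≥0∞) * ENNReal.ofReal (A₀ / δ ^ 2)) := by
          rw [Finset.sum_const, Finset.sum_const, nsmul_eq_mul, nsmul_eq_mul]
      _ ≤ ((M + 1 : ℕ) : ℝ≥0∞) * (((n ^ 3 : ℕ) : ℝ≥0∞) * ENNReal.ofReal (A₀ / δ ^ 2)) :=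
          mul_le_mul' (by exact_mod_cast hStc) (mul_le_mul' (by exact_mod_cast hGxc) le_rfl)
      _ = ENNReal.ofReal (((M : ℝ) + 1) * (n : ℝ) ^ 3 * (A₀ / δ ^ 2)) := by
          rw [← ENNReal.ofReal_natCast, ← ENNReal.ofReal_natCast, ← ENNReal.ofReal_mul (by positivity),
            ← ENNReal.ofReal_mul (by positivity)]
          push_cast
          congr 1
          ring
  calc P {z | ∃ s ∈ Icc 0 t, ∃ x : T3,
        empiricalDensityField (Ψ.flow s z) (fun y => φ (y - x)) < m / 2 ∨
          1 < empiricalDensityField (Ψ.flow s z) (fun y => φ (y - x)) * σ₃}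
      ≤ P ((Ψ.goodᶜ ∪ {z | E₀ < empiricalEnergyField (Ψ.flow 0 z) (fun _ => 1)}) ∪
          ⋃ s ∈ St, ⋃ x ∈ Gx, D s x) := measure_mono hincl
    _ ≤ P Ψ.goodᶜ + P {z | E₀ < empiricalEnergyField (Ψ.flow 0 z) (fun _ => 1)} +
          P (⋃ s ∈ St, ⋃ x ∈ Gx, D s x) :=
        (measure_union_le _ _).trans (add_le_add (measure_union_le _ _) le_rfl)
    _ ≤ 0 + P {z | E₀ < empiricalEnergyField (Ψ.flow 0 z) (fun _ => 1)} +
          ENNReal.ofReal (((M : ℝ) + 1) * (n : ℝ) ^ 3 * (A₀ / δ ^ 2)) :=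
        add_le_add (add_le_add hgood.le le_rfl) (hU.trans hsum)
    _ = _ := by rw [zero_add]

/-! ## Registered Tools sub-stub -/

/-- Registered Tools sub-stub of this helper file (line `meso-chebyshev-window`, stub
`stub_partTwo_of_meanVariance`): the kinetic energy is `N + 1` times the empirical energy field tested against `1`
(`configEnergy_eq_succ_mul_empiricalEnergyField`, the bridge from the crux's energy event to the time modulus). -/
theorem stub_mesoPartTwoGrid : ∀ (N : ℕ) (w : Config (N + 1) (Fin 3) T3), configEnergy w = ((N + 1 : ℕ) : ℝ) * empiricalEnergyField w (fun _ => 1) :=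
  fun _ w => configEnergy_eq_succ_mul_empiricalEnergyField w

end Summit.AtomisticToContinuum.HydrodynamicLimit.Theorems.MesoChebyshevWindow

end
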